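import Summits.QuantumFields.BalabanUV.Beta.D1BFx.ReducedKernel
import Summits.QuantumFields.BalabanUV.Beta.D1BFx.DressedBubbleBridge
import Summits.QuantumFields.BalabanUV.Beta.D1BFx.MomentTransferPeriodicEntry

/-!
# `BalabanUV.Beta.D1BFx.DressedBubbleTable` — road «BF-x» for binder row D1, leaf A4 (part 2, the road's instance): THE BUBBLE
# PART OF THE REDUCED ONE-SHOT KERNEL `TOfRed n a S W` (T8) IS THE `ℋ`-SANDWICH `dressedEntryP (wK n) P^S` (K-R5's input) OF
# THE FINE BUBBLE TABLE `P^S_{κ′λ′}(u, u′) := −½ · bubble (Ga n a) (S κ′ u) (S λ′ u′)`; `P^S` is block periodic, matrix symmetric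
# and exponentially localised; hence (K-R5) its coarse bond second moment EQUALS the base-point average of the fine second
# moment — the dressing cross terms `X_n` of this part VANISH IDENTICALLY given the per-entry row sums (Ward) and base-point-summed
# first moments (parity) of `P^S`

HONEST FRAMING (cell contract, verbatim): «discharging `BetaPertH` makes Bałaban's UV stability UNCONDITIONAL — a real
constructive-QFT result; it is NOT the continuum limit and NOT the Clay problem.»  One definition with a body (`bubbleTable`, [our object])
and [folklore] bookkeeping composed BY NAME from T1/T8 (`GluonLeg.shiftK_Ga_neg`, `ReducedKernel.vertexRed`), part 1 of this leaf
(`DressedBubbleBridge.bubble_wsum_wsum`, `bubble_finset_sum_right`, `loc_wsum`, …), K-R5 (`MomentTransferPeriodicEntry.bondSecondMomentP_solutionOp_four`),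
`ExpKernelCalculus.bubble_shiftK` / `abs_tr_le`, `TameKernelCalculus.tr_comp_comm_loc`, `KernelSpecInstance.decay_wH`.  HYPOTHESES THAT STAY
HYPOTHESES (named, not minted): `Spr (Ga n a)` (the decay binder on the reduced gluon leg — T1's header: B5 Prop. 1.2 content, not in the tree),
the per-entry ROW SUMS of `P^S` (`hrow`; the kernel form of the per-piece Ward identity — node A3.b / an2's Lemma W, to be supplied for
the COMPLETE Hessian kernel of a gauge-invariant piece, of which the bubble table is one summand) and the base-point-summed FIRST
MOMENTS (`hT1`; reflection parity, node R5 (T1)).  Nothing of the manuscripts under audit is asserted or cited; nothing of D1 /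
BetaPertH is discharged.  Value = kernel bookkeeping leaf of road BF-x (skeleton `HOME/beta/skeletons/D1-b2b-balaban-beta-d1-p2.md`
v1.4 nodes R4/R5/A4; `LEAVES-BFx.md` row A4), NOT summit progress; NOT continuum, NOT Clay.
HONEST DEPENDENCY (verbatim): continuum YM on T⁴ ⇐ BetaPertH ∧ nine spine estimates (0/9 proved); BetaPertH ⇐ (D1) ∧ (D4) ∧
CAP+tail; G-an2-4 gates asym, D1 and NE2/3/4.

CONTENT:
* §1 [our object] `bubbleTable n a S : EKer₂ 4`; [folklore] `isBlockPeriodic_bubbleTable` (block covariance of `Ga` + fine-translation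
  covariance of `S`), `bubble_comm` / `bubbleTable_transpose` (MATRIX symmetry `P κ′λ′ u u′ = P λ′κ′ u′ u`, trace cyclicity),
  `exists_decay_bubbleTable` / `absMoment₂_baseKer_bubbleTable` (exponential localisation ⇒ absolutely summable base-point kernels).
* §2 [folklore] THE BRIDGE: `vertexRed_eq_sum_wsum`, **`bubble_vertexRed`** (`bubble (Ga) (vertexRed S μ y) (vertexRed S ν y′) =
  Σ_{κ′λ′} Σ'_{(u,u′)} ℋ ℋ · bubble (Ga) (S κ′ u) (S λ′ u′)`), **`bubblePart_eq_dressedEntryP`**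
  (`−½·bubble (Ga) (vertexRed S μ 0) (vertexRed S ν z) = dressedEntryP (wK n) (bubbleTable n a S) (n•(−z)) μ ν`).
* §3 [folklore] THE COMPOSITION WITH K-R5: **`bubblePart_bondSecondMoment_eq_avgM2`** — given `hrow` and `hT1`, the coarse bond second
  moment of the bubble part of `TOfRed` equals `avgM2 n (bubbleTable n a S μ ν) κ λ` (the dressing cross terms of this part are ZERO).
-/

noncomputable section

namespace Summit.QuantumFields.BalabanUV.Beta.D1BFx.DressedBubbleTable

open Finset
open scoped BigOperators
open Literature.MathematicalPhysics.QuantumFieldTheory.Balaban1983to89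
open Literature.MathematicalPhysics.QuantumFieldTheory.Balaban1983to89.Beta
open B12Sec2to5 (l1 l1_nonneg Decay510)
open ExpKernelCalculus (Site MKer Decays BiLoc comp tr bubble shiftK bubble_shiftK Zl Zl_nonneg biLoc_comp_decays biLoc_comp_biLoc
  abs_tr_le)
open DecimatedMoment (cosetInd)
open DecimatedMomentSummable (AbsMoment₂ absMoment₂_of_decay510)
open DressedMomentNormalisation (EKer resSite)
open KernelSpecInstance (wH decay_wH)
open MinimiserIdentityForm (wK)
open OneStepResolventKernel (wsum)
open Summit.QuantumFields.BalabanUV.Beta.TameKernelCalculus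
open Summit.QuantumFields.BalabanUV.Beta.KernelWardRelative (loc_finset_sum bubble_finset_sum_left)
open Summit.QuantumFields.BalabanUV.Beta.D1BFx.GluonLeg (Ga shiftK_Ga_neg)
open Summit.QuantumFields.BalabanUV.Beta.D1BFx.ReducedKernel (StencilR vertexRed TOfRed)
open Summit.QuantumFields.BalabanUV.Beta.D1BFx.DressedBubbleBridge
open Summit.QuantumFields.BalabanUV.Beta.D1BFx.MomentTransferPeriodic (Ker₂ IsBlockPeriodic baseKer)
open Summit.QuantumFields.BalabanUV.Beta.D1BFx.MomentTransferPeriodicSum (dressedSumP)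
open Summit.QuantumFields.BalabanUV.Beta.D1BFx.MomentTransferPeriodicEntry (EKer₂ dressedEntryP avgM2
  bondSecondMomentP_solutionOp_four)

variable (n : ℕ) [NeZero n] (a : ℝ)

/-! ## §1 The fine bubble table of a reduced stencil family -/

/-- [our object] **THE FINE BUBBLE TABLE** of a reduced first-order stencil family over the reduced gluon leg:
`bubbleTable n a S κ′ λ′ u u′ := −½ · bubble (Ga n a) (S κ′ u) (S λ′ u′)` — the two-point fine kernel whose `ℋ`-sandwich is the bubble part
of `TOfRed n a S W` (§2).  A DEFINITION; asserts nothing. -/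
def bubbleTable (S : StencilR) : EKer₂ 4 :=
  fun κ' l' u u' => -(1 / 2 : ℝ) * bubble (Ga n a) (S κ' u) (S l' u')

/-- [our object] Unfolding. -/
theorem bubbleTable_apply (S : StencilR) (κ' l' : Fin 4) (u u' : Site 4) :
    bubbleTable n a S κ' l' u u' = -(1 / 2 : ℝ) * bubble (Ga n a) (S κ' u) (S l' u') := rfl

/-- [folklore] **BLOCK PERIODICITY** of every entry of the bubble table, for a fine-translation-covariant stencil family
(`S κ′ (u + v) = shiftK (−v) (S κ′ u)`): joint translation by `n•t` is absorbed by the block covariance of `Ga` (`shiftK_Ga_neg`) and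
`bubble_shiftK`. -/
theorem isBlockPeriodic_bubbleTable (hn : 1 ≤ n) {S : StencilR}
    (hS : ∀ (κ' : Fin 4) (u v : Site 4), S κ' (u + v) = shiftK (-v) (S κ' u)) (κ' l' : Fin 4) :
    IsBlockPeriodic n (bubbleTable n a S κ' l') := by
  intro t s s'
  simp only [bubbleTable_apply]
  rw [hS κ' s ((n : ℤ) • t), hS l' s' ((n : ℤ) • t)]
  conv_lhs => rw [← shiftK_Ga_neg n a hn t]
  rw [bubble_shiftK]

/-- [folklore] **THE BUBBLE IS SYMMETRIC IN ITS TWO VERTICES** for a spread resolvent and localised vertices (cyclicity of the trace,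
`TameKernelCalculus.tr_comp_comm_loc`). -/
theorem bubble_comm {A V W : MKer 4 (Fin 4)} (hA : Spr A) (hV : Loc V) (hW : Loc W) : bubble A V W = bubble A W V := by
  unfold ExpKernelCalculus.bubble
  exact tr_comp_comm_loc (hA.comp_loc hV) (hA.comp_loc hW).tame

/-- [folklore] **MATRIX SYMMETRY OF THE BUBBLE TABLE**: `P κ′ λ′ u u′ = P λ′ κ′ u′ u`. -/
theorem bubbleTable_transpose {S : StencilR} (hGa : Spr (Ga n a)) {Cs δ : ℝ} (hS : ∀ κ' u, BiLoc (S κ' u) u u Cs δ) (hδ : 0 < δ)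
    (κ' l' : Fin 4) (u u' : Site 4) : bubbleTable n a S κ' l' u u' = bubbleTable n a S l' κ' u' u := by
  simp only [bubbleTable_apply]
  rw [bubble_comm hGa ⟨u, u, Cs, δ, hδ, hS κ' u⟩ ⟨u', u', Cs, δ, hδ, hS l' u'⟩]

/-- [folklore] **EXPONENTIAL LOCALISATION OF THE BUBBLE TABLE IN THE SEPARATION**: `|P κ′λ′ (b + t) b| ≤ C′ e^{−δ′|t|₁}` with ONE pair
`(C′, δ′)` for all entries and base points (the localisation of `(Ga∘S_{κ′,b+t})∘(Ga∘S_{λ′,b})` at `(b+t, b)` read through `abs_tr_le`). -/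
theorem exists_decay_bubbleTable {S : StencilR} (hGa : Spr (Ga n a)) {Cs δ : ℝ} (hS : ∀ κ' u, BiLoc (S κ' u) u u Cs δ) (hδ : 0 < δ) :
    ∃ C' δ' : ℝ, 0 < δ' ∧ ∀ (κ' l' : Fin 4) (b : Site 4), Decay510 (baseKer (bubbleTable n a S κ' l') b) C' δ' := by
  obtain ⟨CA, δA, hδA, hAd⟩ := hGa
  set m : ℝ := min δA δ with hm
  have hm0 : 0 < m := lt_min hδA hδ
  have hm2 : 0 < m / 2 := half_pos hm0
  have hAd' : Decays (Ga n a) (|CA|) m := decays_of_le hAd (min_le_left _ _)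
  have hS' : ∀ κ' u, BiLoc (S κ' u) u u (|Cs|) m := fun κ' u => biLoc_of_le (hS κ' u) (min_le_right _ _)
  set C1 : ℝ := (Fintype.card (Fin 4) : ℝ) * (|CA| * |Cs|) * Zl 4 (m - m / 2)
  set C3 : ℝ := (Fintype.card (Fin 4) : ℝ) * (C1 * C1) * Zl 4 (m / 2 / 2)
  have hC10 : 0 ≤ C1 := mul_nonneg (by positivity) (Zl_nonneg (by linarith))
  have hC30 : 0 ≤ C3 := mul_nonneg (mul_nonneg (Nat.cast_nonneg _) (mul_nonneg hC10 hC10)) (Zl_nonneg (by linarith))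
  refine ⟨1 / 2 * ((Fintype.card (Fin 4) : ℝ) * C3 * Zl 4 (m / 2 / 2)), m / 2 / 2, by positivity, fun κ' l' b t => ?_⟩
  have h1 : BiLoc (comp (Ga n a) (S κ' (b + t))) (b + t) (b + t) C1 (m / 2) :=
    biLoc_comp_decays hAd' (hS' κ' (b + t)) hm2.le (by linarith)
  have h2 : BiLoc (comp (Ga n a) (S l' b)) b b C1 (m / 2) := biLoc_comp_decays hAd' (hS' l' b) hm2.le (by linarith)
  have h3 : BiLoc (comp (comp (Ga n a) (S κ' (b + t))) (comp (Ga n a) (S l' b))) (b + t) b C3 (m / 2) :=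
    biLoc_const_mono (biLoc_comp_biLoc h1 h2 hm2)
      (mul_le_of_le_one_right hC30 (Real.exp_le_one_iff.2 (by nlinarith [l1_nonneg (b + t - b)])))
  have h4 := abs_tr_le h3 hm2
  rw [add_sub_cancel_left] at h4
  simp only [baseKer, bubbleTable_apply, ExpKernelCalculus.bubble, abs_mul]
  rw [show |(-(1 / 2 : ℝ))| = 1 / 2 by norm_num, mul_assoc]
  exact mul_le_mul_of_nonneg_left h4 (by norm_num)

/-- [folklore] Hence every base-point kernel of every entry has an absolutely summable second moment. -/
theorem absMoment₂_baseKer_bubbleTable {S : StencilR} (hGa : Spr (Ga n a)) {Cs δ : ℝ} (hS : ∀ κ' u, BiLoc (S κ' u) u u Cs δ)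
    (hδ : 0 < δ) (κ' l' : Fin 4) (b : Site 4) : AbsMoment₂ (baseKer (bubbleTable n a S κ' l') b) := by
  obtain ⟨C', δ', hδ', h⟩ := exists_decay_bubbleTable n a hGa hS hδ
  exact absMoment₂_of_decay510 hδ' (h κ' l' b)

/-! ## §2 The bridge: the bubble of `ℋ`-dressed vertices is the `ℋ`-sandwich of the bubble table -/

/-- [folklore] `vertexRed n S μ y` as a finite sum of weighted superpositions (as a kernel). -/
theorem vertexRed_eq_sum_wsum (S : StencilR) (μ : Fin 4) (y : Site 4) :
    vertexRed n S μ y = ∑ κ' : Fin 4, wsum (fun u => wH (N := n) (d := 3) κ' μ (u - (n : ℤ) • y)) (S κ') := by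
  funext x z a' b
  simp only [vertexRed, Finset.sum_apply]

/-- [folklore] The `ℋ`-weights decay exponentially from the coarse bond position (`KernelSpecInstance.decay_wH`). -/
theorem exists_expWeight_wH :
    ∃ Cw δw : ℝ, 0 ≤ Cw ∧ 0 < δw ∧ ∀ (κ' μ : Fin 4) (y u : Site 4),
      |wH (N := n) (d := 3) κ' μ (u - (n : ℤ) • y)| ≤ Cw * Real.exp (-δw * l1 (u - (n : ℤ) • y)) := by
  obtain ⟨δw, Cw, hδw, h⟩ := decay_wH (N := n) (d := 3)
  have hCw : 0 ≤ Cw := by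
    have h0 := h 0 0 0
    have e : l1 (0 : Site 4) = 0 := by simp [l1]
    rw [e, mul_zero, Real.exp_zero, mul_one] at h0
    exact (abs_nonneg _).trans h0
  exact ⟨Cw, δw, hCw, hδw, fun κ' μ y u => h κ' μ (u - (n : ℤ) • y)⟩

/-- [folklore] Each summand of `vertexRed` is a localised kernel. -/
theorem loc_wsum_wH {S : StencilR} {Cs δ : ℝ} (hS : ∀ κ' u, BiLoc (S κ' u) u u Cs δ) (hδ : 0 < δ) (κ' μ : Fin 4) (y : Site 4) :
    Loc (wsum (fun u => wH (N := n) (d := 3) κ' μ (u - (n : ℤ) • y)) (S κ')) := by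
  obtain ⟨Cw, δw, hCw, hδw, hw⟩ := exists_expWeight_wH n
  have hCs : 0 ≤ Cs := (hS κ' 0).nonneg 0
  have hm : 0 < min δw δ := lt_min hδw hδ
  exact loc_wsum (fun u => expWeight_of_le (hw κ' μ y) hCw (min_le_left _ _) u) hCw
    (fun u => biLoc_of_le (hS κ' u) (min_le_right _ _)) hm

/-- [folklore] **THE BUBBLE OF TWO `ℋ`-DRESSED VERTICES IS THE `ℋ ⊗ ℋ`-SUPERPOSITION OF THE STENCIL BUBBLES**:
`bubble (Ga) (vertexRed S μ y) (vertexRed S ν y′) = Σ_{κ′} Σ_{λ′} Σ'_{(u,u′)} ℋ_{(κ′,u),(μ,y)} ℋ_{(λ′,u′),(ν,y′)} · bubble (Ga) (S κ′ u) (S λ′ u′)`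
(finite additivity in both slots + `DressedBubbleBridge.bubble_wsum_wsum`). -/
theorem bubble_vertexRed {S : StencilR} (hGa : Spr (Ga n a)) {Cs δ : ℝ} (hS : ∀ κ' u, BiLoc (S κ' u) u u Cs δ) (hδ : 0 < δ)
    (μ ν : Fin 4) (y y' : Site 4) :
    bubble (Ga n a) (vertexRed n S μ y) (vertexRed n S ν y')
      = ∑ κ' : Fin 4, ∑ l' : Fin 4, ∑' q : Site 4 × Site 4,
          wH (N := n) (d := 3) κ' μ (q.1 - (n : ℤ) • y) * wH (N := n) (d := 3) l' ν (q.2 - (n : ℤ) • y')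
            * bubble (Ga n a) (S κ' q.1) (S l' q.2) := by
  obtain ⟨Cw, δw, hCw, hδw, hw⟩ := exists_expWeight_wH n
  rw [vertexRed_eq_sum_wsum n S μ y, vertexRed_eq_sum_wsum n S ν y',
    bubble_finset_sum_left _ hGa (fun κ' => loc_wsum_wH n hS hδ κ' μ y) (loc_finset_sum _ fun l' => loc_wsum_wH n hS hδ l' ν y')]
  refine Finset.sum_congr rfl fun κ' _ => ?_
  rw [bubble_finset_sum_right _ hGa (loc_wsum_wH n hS hδ κ' μ y) (fun l' => loc_wsum_wH n hS hδ l' ν y')]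
  refine Finset.sum_congr rfl fun l' _ => ?_
  exact bubble_wsum_wsum hGa (hw κ' μ y) hδw (hw l' ν y') hCw hδw (fun u => hS κ' u) (fun u => hS l' u) hδ

/-- [folklore] **THE BUBBLE PART OF `TOfRed` IS K-R5's SANDWICH**: with the base point `0` on the left,
`−½ · bubble (Ga) (vertexRed S μ 0) (vertexRed S ν z) = dressedEntryP (wK n) (bubbleTable n a S) (n • (−z)) μ ν` — reindex the right
fine point by the block translation `u′ = x + n•z` and use block periodicity of the table. -/
theorem bubblePart_eq_dressedEntryP (hn : 1 ≤ n) {S : StencilR} (hGa : Spr (Ga n a)) {Cs δ : ℝ}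
    (hS : ∀ κ' u, BiLoc (S κ' u) u u Cs δ) (hδ : 0 < δ)
    (hScov : ∀ (κ' : Fin 4) (u v : Site 4), S κ' (u + v) = shiftK (-v) (S κ' u)) (μ ν : Fin 4) (z : Site 4) :
    -(1 / 2 : ℝ) * bubble (Ga n a) (vertexRed n S μ 0) (vertexRed n S ν z)
      = dressedEntryP (wK n) (bubbleTable n a S) ((n : ℤ) • (-z)) μ ν := by
  rw [bubble_vertexRed n a hGa hS hδ μ ν 0 z, Finset.mul_sum]
  simp only [dressedEntryP, dressedSumP]
  refine Finset.sum_congr rfl fun κ' _ => ?_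
  rw [Finset.mul_sum]
  refine Finset.sum_congr rfl fun l' _ => ?_
  rw [← tsum_mul_left]
  -- reindex the second fine point: `u' = x + n•z`
  rw [← (Equiv.prodCongr (Equiv.refl (Site 4)) (Equiv.addRight ((n : ℤ) • z))).tsum_eq]
  refine tsum_congr fun q => ?_
  obtain ⟨u, x⟩ := q
  simp only [Equiv.prodCongr_apply, Prod.map_apply, Equiv.refl_apply, Equiv.coe_addRight, smul_zero, sub_zero,
    add_sub_cancel_right, bubbleTable_apply]
  have hper := isBlockPeriodic_bubbleTable n a hn hScov κ' l' (-z) u (x + (n : ℤ) • z)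
  rw [bubbleTable_apply, bubbleTable_apply, smul_neg, show x + (n : ℤ) • z + -((n : ℤ) • z) = x by abel] at hper
  rw [show (n : ℤ) • -z + u = u + -((n : ℤ) • z) by rw [smul_neg]; abel, hper]
  simp only [wK]
  ring

/-! ## §3 Composition with K-R5: the coarse bond second moment of the bubble part is the base-point average -/

/-- [folklore] Rows summing to zero for EVERY entry ⟹ columns summing to zero for every entry (matrix symmetry of the table). -/
theorem hasSum_col_bubbleTable {S : StencilR} (hGa : Spr (Ga n a)) {Cs δ : ℝ} (hS : ∀ κ' u, BiLoc (S κ' u) u u Cs δ) (hδ : 0 < δ)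
    (hrow : ∀ (κ' l' : Fin 4) (b : Site 4), HasSum (bubbleTable n a S κ' l' b) 0) (κ' l' : Fin 4) (b : Site 4) :
    HasSum (fun s => bubbleTable n a S κ' l' s b) 0 :=
  (hrow l' κ' b).congr_fun fun s => bubbleTable_transpose n a hGa hS hδ κ' l' s b

/-- [folklore] **A4 FOR THE BUBBLE PART — THE DRESSING CROSS TERMS VANISH IDENTICALLY.**  Reduced stencil family `S` self-localised and
fine-translation covariant, `Spr (Ga n a)` (HONEST decay binder), block size `n ≥ 1`; GIVEN (hypotheses, to be supplied by the road's
Ward / parity leaves for the complete gauge-invariant piece) that every entry of the fine bubble table has ROWS SUMMING TO ZERO and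
BASE-POINT-SUMMED FIRST MOMENTS ZERO: the coarse bond second moment of the bubble part of `TOfRed n a S W`,
`Σ'_z z_κ z_λ · n⁸ · (−½·bubble (Ga) (vertexRed S μ 0) (vertexRed S ν z))`, EQUALS `avgM2 n (bubbleTable n a S μ ν) κ λ` — the base-point
average over one block of the fine second moment of the `(μ, ν)` entry of the table (K-R5, `bondSecondMomentP_solutionOp_four`, with the
dressing side discharged for the typed solution operator `wK n`).  NO cross term survives. -/
theorem bubblePart_bondSecondMoment_eq_avgM2 (hn : 1 ≤ n) {S : StencilR} (hGa : Spr (Ga n a)) {Cs δ : ℝ}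
    (hS : ∀ κ' u, BiLoc (S κ' u) u u Cs δ) (hδ : 0 < δ)
    (hScov : ∀ (κ' : Fin 4) (u v : Site 4), S κ' (u + v) = shiftK (-v) (S κ' u))
    (hrow : ∀ (κ' l' : Fin 4) (b : Site 4), HasSum (bubbleTable n a S κ' l' b) 0)
    (hT1 : ∀ (κ' l' μ' : Fin 4), ∑ r : Fin 4 → Fin n, ∑' t, (t μ' : ℝ) * baseKer (bubbleTable n a S κ' l') (resSite r) t = 0)
    (κ lam μ ν : Fin 4) :
    ∑' z : Site 4, ((z κ * z lam : ℤ) : ℝ) * ((n : ℝ) ^ 8 * (-(1 / 2 : ℝ) * bubble (Ga n a) (vertexRed n S μ 0) (vertexRed n S ν z)))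
      = avgM2 n (bubbleTable n a S μ ν) κ lam := by
  have h := bondSecondMomentP_solutionOp_four (N := n) (bubbleTable n a S) (fun c e => isBlockPeriodic_bubbleTable n a hn hScov c e)
    (fun c e b => absMoment₂_baseKer_bubbleTable n a hGa hS hδ c e b) (hasSum_col_bubbleTable n a hGa hS hδ hrow) hrow hT1 κ lam μ ν
  rw [← h, ← (Equiv.neg (Site 4)).tsum_eq]
  refine tsum_congr fun z => ?_
  rw [bubblePart_eq_dressedEntryP n a hn hGa hS hδ hScov μ ν]
  simp only [Equiv.neg_apply, Pi.neg_apply, neg_mul_neg, neg_neg]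

/-- [folklore] The same in `B12Beta.secondMoment` currency (integrand order `T z · z_κ · z_λ`, no bond factor): the plain second moment
of the bubble part of `TOfRed` is `n⁻⁸ · avgM2 n (bubbleTable n a S μ ν) κ λ`. -/
theorem secondMoment_bubblePart_eq (hn : 1 ≤ n) {S : StencilR} (hGa : Spr (Ga n a)) {Cs δ : ℝ}
    (hS : ∀ κ' u, BiLoc (S κ' u) u u Cs δ) (hδ : 0 < δ)
    (hScov : ∀ (κ' : Fin 4) (u v : Site 4), S κ' (u + v) = shiftK (-v) (S κ' u))
    (hrow : ∀ (κ' l' : Fin 4) (b : Site 4), HasSum (bubbleTable n a S κ' l' b) 0)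
    (hT1 : ∀ (κ' l' μ' : Fin 4), ∑ r : Fin 4 → Fin n, ∑' t, (t μ' : ℝ) * baseKer (bubbleTable n a S κ' l') (resSite r) t = 0)
    (κ lam μ ν : Fin 4) :
    ∑' z : Site 4, (-(1 / 2 : ℝ) * bubble (Ga n a) (vertexRed n S μ 0) (vertexRed n S ν z)) * (z κ : ℝ) * (z lam : ℝ)
      = ((n : ℝ) ^ 8)⁻¹ * avgM2 n (bubbleTable n a S μ ν) κ lam := by
  have hn' : (n : ℝ) ^ 8 ≠ 0 := pow_ne_zero 8 (by exact_mod_cast (show n ≠ 0 by omega))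
  have h := bubblePart_bondSecondMoment_eq_avgM2 n a hn hGa hS hδ hScov hrow hT1 κ lam μ ν
  have e : (fun z : Site 4 => ((z κ * z lam : ℤ) : ℝ) * ((n : ℝ) ^ 8
      * (-(1 / 2 : ℝ) * bubble (Ga n a) (vertexRed n S μ 0) (vertexRed n S ν z))))
      = fun z => (n : ℝ) ^ 8 * ((-(1 / 2 : ℝ) * bubble (Ga n a) (vertexRed n S μ 0) (vertexRed n S ν z)) * (z κ : ℝ) * (z lam : ℝ)) := by
    funext z
    push_cast
    ring
  rw [e, tsum_mul_left] at h
  rw [← h, ← mul_assoc, inv_mul_cancel₀ hn', one_mul]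

end Summit.QuantumFields.BalabanUV.Beta.D1BFx.DressedBubbleTable

end
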